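import Summits.QuantumFields.YangMills.Theorems.ColdStartUniversalityShenZhuZhuHaarCeilingLimitSUN
import Summits.QuantumFields.YangMills.Theorems.ColdStartUniversalityShenZhuZhuKernelPoincareSUN
import Literature.MathematicalPhysics.QuantumLattice.LatticeGaugeDLRProofs
import HarnessLib

/-!
# The Haar ceiling for the DLR KERNELS: interior links of `γ_E(·|η)` are Haar-distributed at every coupling and boundary condition, so the
# uniform kernel Poincaré constant of `SU(N)` lattice Yang–Mills can never exceed `(N² − 1)/N` (companion upper bound to G32's `N/2 − 4dN|β|`)

Seat `ym-line-csu-p1` (g40), route `ColdStartUniversality` of `Summits/QuantumFields/YangMills`, helper file G38 (`--supports stmt-QuantumFields-24809`).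
G32 proved the UNIFORM kernel Poincaré inequality `K·Var_{γ_E(·|η)}(F) ≤ Σ_{e∈E} ∫|∇_e F|² dγ_E(·|η)` with `K = N/2 − 4dN|β|` for every region `E` and
boundary condition `η`; this file bounds ANY such uniform constant from above at EVERY coupling: `K ≤ N − 1/N`.  Mechanism (Elitzur, as in G33/G36):
the kernel is gauge covariant (`ymSpecification_map_gaugeTransformZd_holds`) and depends on `η` only off `E`, so for a site `x` whose whole star of
links lies in `E` the gauge rotation at `x` preserves `γ_E(·|η)`; the law of an outgoing link `U_{(x,i)}` is therefore Haar.

* §1 `ymSpecification_congr_off` (kernels depend on the boundary condition only off the region); ★★ `integral_link_eq_haar_kernel_sun` — for `e₀ = (x,i)`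
  with the star of `x` inside `E`: `∫ g(U_{e₀}) dγ_E(·|η) = ∫ g dσ_{SU(N)}` (continuous `g`), every `β'`, `η`, `N`, `d`.
* §2 `linkGradSq_linkEntry_region_eq` — for the one-link entry cylinder over `E`, `|∇_e F|² = Γ₁(Re tr(·M))(U_{e₀})` at `e = e₀` and `0` otherwise;
  `rayleigh_linkEntries_kernel_sun`.
* §3 ★★★ `kernelPoincareConst_le_haarCeiling_sun` — if `K·Var_{γ_E(·|η)}(F) ≤ Σ_{e∈E} ∫ linkGradSq E f e dγ_E(·|η)` for every smooth `f` over a region `E`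
  containing the star of a site, then `K ≤ N − 1/N` (`N ≥ 2`, any `d ≥ 1`, `β'`, `η`); with G32: the optimal UNIFORM kernel constant at `|β| < 1/(8d)` lies in
  `[N/2 − 4dN|β|, N − 1/N]` (`kernelPoincareConst_window_sun`).

THEOREMS ONLY, no definition, no sorry.  HONEST FRAMING: fixed-lattice structural facts (upper bounds on lattice-unit gaps); nothing `K`-uniform along the
route's scaling (`UniformColdStartMixing`, 24809, ASIDE, not restated); no crux, rung or summit statement is proved; the Yang–Mills mass gap is NOT proved.
References: S. Elitzur, Phys. Rev. D 12 (1975) 3978 [Elitzur1975]; H.-O. Georgii, Gibbs Measures and Phase Transitions (2011), (2.15); H. Shen, R. Zhu,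
X. Zhu, CMP 400 (2023) Remark 1.3 [ShenZhuZhu2022].
-/

set_option autoImplicit false

noncomputable section

namespace Summit.QuantumFields.YangMills.Theorems.ColdStartUniversality

open MeasureTheory ProbabilityTheory Finset Filter Set Function
open scoped BigOperators NNReal ENNReal Topology Matrix Matrix.Norms.Frobenius ContDiff
open Literature.MathematicalPhysics.QuantumFieldTheory
open Literature.MathematicalPhysics.QuantumLattice (fundamentalRep continuous_fundamentalRep fundamentalRep_apply LGConfig ymSpecification
  gaugeTransformZd ymSpecification_map_gaugeTransformZd_holds isProbabilityMeasure_ymSpecification)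
open Literature.Probability.LatticeModels (glueWith glueWith_apply_mem glueWith_apply_not_mem measurable_glueWith)
open Literature.MathematicalPhysics.QuantumFieldTheory.SUNBakryEmery (SUN FrameIdx frame contDiff_reTrMul reTrMul haarSU)

variable {d N : ℕ}

/-! ## §1. Interior links of the DLR kernels are Haar -/

/-- The DLR kernel `γ_E(·|η)` depends on the boundary condition `η` only off `E`. [folklore] -/
theorem ymSpecification_congr_off {N' : ℕ} (ρ : SUN N →* Matrix (Fin N') (Fin N') ℂ)
    (β : ℝ) (E : Finset (Literature.MathematicalPhysics.QuantumLattice.ZdEdge d)) {η η' : LGConfig d (SUN N)} (h : ∀ e ∉ E, η e = η' e) :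
    ymSpecification ρ β E η = ymSpecification ρ β E η' := by
  have hg : (fun ζ : ↥E → SUN N => glueWith E ζ η) = fun ζ => glueWith E ζ η' := by
    funext ζ; funext e
    by_cases he : e ∈ E
    · rw [glueWith_apply_mem E ζ η he, glueWith_apply_mem E ζ η' he]
    · rw [glueWith_apply_not_mem E ζ η he, glueWith_apply_not_mem E ζ η' he, h e he]
  unfold ymSpecification
  rw [hg]

/-- ★★ **Interior links of the DLR kernels are Haar-distributed** (Elitzur for the kernels): for every region `E`, boundary condition `η`, coupling
`β'`, and every link `e₀ = (x, i)` such that ALL links touching the site `x` lie in `E`, `∫ g(U_{e₀}) dγ_E(·|η) = ∫ g dσ_{SU(N)}` for continuous `g` —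
the gauge rotation at `x` preserves `γ_E(·|η)` (gauge covariance + §1) and maps `U_{e₀} ↦ k U_{e₀}`. [cite: Elitzur1975, (local gauge invariance)] -/
theorem integral_link_eq_haar_kernel_sun (β' : ℝ) (E : Finset (Literature.MathematicalPhysics.QuantumLattice.ZdEdge d)) (η : LGConfig d (SUN N))
    (e₀ : Literature.MathematicalPhysics.QuantumLattice.ZdEdge d)
    (hx : ∀ e : Literature.MathematicalPhysics.QuantumLattice.ZdEdge d, (e.1 = e₀.1 ∨ e.1 + Pi.single e.2 1 = e₀.1) → e ∈ E)
    {g : SUN N → ℝ} (hg : Continuous g) :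
    ∫ U, g (U e₀) ∂(ymSpecification (fundamentalRep (Fin N)) β' E η) = ∫ x, g x ∂(haarProbability (SUN N)) := by
  haveI : SecondCountableTopology (Matrix (Fin N) (Fin N) ℂ) := inferInstanceAs (SecondCountableTopology (Fin N → Fin N → ℂ))
  haveI : SecondCountableTopology (SUN N) := Topology.IsEmbedding.subtypeVal.secondCountableTopology
  set γ := ymSpecification (fundamentalRep (Fin N)) β' E η with hγ
  haveI : IsProbabilityMeasure γ := isProbabilityMeasure_ymSpecification (fundamentalRep (Fin N)) (continuous_fundamentalRep (n := Fin N)) β' E η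
  obtain ⟨B, hB⟩ : ∃ B, ∀ x : SUN N, |g x| ≤ B := by
    obtain ⟨B, hB⟩ := (isCompact_univ (X := SUN N)).exists_bound_of_continuousOn hg.continuousOn
    exact ⟨B, fun x => by simpa [Real.norm_eq_abs] using hB x (Set.mem_univ _)⟩
  -- the rotation at the source `x` of `e₀`
  set ρk : SUN N → Literature.Probability.LatticeModels.Site d → SUN N := fun k => Function.update (fun _ => (1 : SUN N)) e₀.1 k with hρk
  have hne : e₀.1 + Pi.single e₀.2 1 ≠ e₀.1 := by
    intro h
    have h1 := congrFun h e₀.2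
    simp at h1
  have hrot : ∀ (k : SUN N) (U : LGConfig d (SUN N)), gaugeTransformZd (ρk k) U e₀ = k * U e₀ := by
    intro k U
    simp only [gaugeTransformZd, hρk, Function.update_self, Function.update_of_ne hne, inv_one, mul_one]
  have hoff : ∀ k : SUN N, ∀ e ∉ E, gaugeTransformZd (ρk k) η e = η e := by
    intro k e he
    have h1 : e.1 ≠ e₀.1 := fun h => he (hx e (Or.inl h))
    have h2 : e.1 + Pi.single e.2 1 ≠ e₀.1 := fun h => he (hx e (Or.inr h))
    simp only [gaugeTransformZd, hρk, Function.update_of_ne h1, Function.update_of_ne h2, one_mul, inv_one, mul_one]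
  -- step 1: invariance of the kernel under each rotation
  have h1 : ∀ k : SUN N, ∫ U, g (k * U e₀) ∂γ = ∫ U, g (U e₀) ∂γ := by
    intro k
    have hmap := ymSpecification_map_gaugeTransformZd_holds (d := d) (fundamentalRep (Fin N)) (continuous_fundamentalRep (n := Fin N)) β' E η (ρk k)
    rw [ymSpecification_congr_off (fundamentalRep (Fin N)) β' E (hoff k)] at hmap
    have hmeas : Measurable (gaugeTransformZd (ρk k) : LGConfig d (SUN N) → LGConfig d (SUN N)) :=
      measurable_pi_lambda _ fun e => (measurable_const.mul (measurable_pi_apply e)).mul measurable_const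
    have h := integral_map (μ := γ) hmeas.aemeasurable (f := fun U : LGConfig d (SUN N) => g (U e₀)) ((hg.comp (continuous_apply e₀)).aestronglyMeasurable)
    rw [hγ] at h ⊢
    rw [hmap] at h
    simp only [hrot] at h
    exact h.symm
  -- step 2: average over `k`
  have hmeas : Measurable fun p : SUN N × LGConfig d (SUN N) => g (p.1 * p.2 e₀) :=
    hg.measurable.comp (measurable_fst.mul ((measurable_pi_apply e₀).comp measurable_snd))
  have hint : Integrable (fun p : SUN N × LGConfig d (SUN N) => g (p.1 * p.2 e₀)) ((haarProbability (SUN N)).prod γ) :=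
    (integrable_const B).mono' hmeas.aestronglyMeasurable (ae_of_all _ fun p => by rw [Real.norm_eq_abs]; exact hB _)
  calc ∫ U, g (U e₀) ∂γ = ∫ k, ∫ U, g (k * U e₀) ∂γ ∂(haarProbability (SUN N)) := by simp_rw [h1]; simp
    _ = ∫ U, ∫ k, g (k * U e₀) ∂(haarProbability (SUN N)) ∂γ := integral_integral_swap hint
    _ = ∫ U, ∫ k, g k ∂(haarProbability (SUN N)) ∂γ := by
        refine integral_congr_ae (ae_of_all _ fun U => ?_)
        exact integral_mul_right_eq_self (μ := haarProbability (SUN N)) g (U e₀)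
    _ = ∫ x, g x ∂(haarProbability (SUN N)) := by simp

/-! ## §2. The one-link entry cylinders over a region -/

/-- For the entry cylinder `F = Re tr(U_{e₀} M)` over `E ∋ e₀`: `|∇_e F|²(U) = Γ₁(Re tr(·M))(U_{e₀})` for `e = e₀` and `0` for `e ≠ e₀`, at `SU(N)`
configurations. [cite: ShenZhuZhu2022, §2 (2.3)–(2.4)] -/
theorem linkGradSq_linkEntry_region_eq (hN : N ≠ 0) (E : Finset (Literature.MathematicalPhysics.QuantumLattice.ZdEdge d)) (e₀ : ↥E)
    (M : Matrix (Fin N) (Fin N) ℂ) (e : ↥E) (U : LGConfig d (SUN N)) :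
    linkGradSq E (fun m : (↥E → Matrix (Fin N) (Fin N) ℂ) => (m e₀ * M).trace.re) e (fun e' => ((U e'.1 : SUN N) : Matrix (Fin N) (Fin N) ℂ)) =
      if e = e₀ then SUNBakryEmery.Gam (fun Q : Matrix (Fin N) (Fin N) ℂ => (Q * M).trace.re) (fun Q => (Q * M).trace.re) ((U e₀.1 : SUN N) : Matrix (Fin N) (Fin N) ℂ)
      else 0 := by
  classical
  set P : (↥E → Matrix (Fin N) (Fin N) ℂ) →L[ℝ] Matrix (Fin N) (Fin N) ℂ :=
    ContinuousLinearMap.proj (R := ℝ) (φ := fun _ : ↥E => Matrix (Fin N) (Fin N) ℂ) e₀ with hP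
  have hf : (fun m : (↥E → Matrix (Fin N) (Fin N) ℂ) => (m e₀ * M).trace.re) = ⇑((reTrMul M).comp P) := rfl
  have hfd : Differentiable ℝ (fun m : (↥E → Matrix (Fin N) (Fin N) ℂ) => (m e₀ * M).trace.re) := by
    rw [hf]; exact ((reTrMul M).comp P).differentiable
  set m₀ : ↥E → Matrix (Fin N) (Fin N) ℂ := fun e' => ((U e'.1 : SUN N) : Matrix (Fin N) (Fin N) ℂ) with hm₀
  rw [linkGradSq_eq_sum_sq_fderiv _ hfd e m₀]
  have hder : ∀ v, fderiv ℝ (fun m : (↥E → Matrix (Fin N) (Fin N) ℂ) => (m e₀ * M).trace.re) m₀ v = (v e₀ * M).trace.re := by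
    intro v; rw [hf, ((reTrMul M).comp P).fderiv]; rfl
  simp only [hder]
  by_cases he : e = e₀
  · subst he
    simp only [Pi.single_eq_same, if_true]
    have hUe : m₀ e ∈ Matrix.unitaryGroup (Fin N) ℂ := (U e.1).2.1
    have h := SUNBakryEmery.sum_sq_apply_frame_mul_eq_sum_sq_apply_mul_frame hN ((reTrMul M).toLinearMap)
      (Matrix.mem_unitaryGroup_iff.1 hUe) (Matrix.mem_unitaryGroup_iff'.1 hUe)
    simp only [ContinuousLinearMap.coe_coe, SUNBakryEmery.reTrMul_apply] at h
    rw [h]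
    simp only [SUNBakryEmery.Gam, SUNBakryEmery.matD_reTrMul, sq]
    rfl
  · rw [if_neg he]
    refine Finset.sum_eq_zero fun α _ => ?_
    rw [Pi.single_eq_of_ne (Ne.symm he), Matrix.zero_mul, Matrix.trace_zero, Complex.zero_re, sq, mul_zero]

/-- **Rayleigh sums under a kernel with an interior star**: `Σ_F Σ_{e∈E} ∫|∇_e F|² dγ_E(·|η) = (N − 1/N)·N` and `Σ_F Var_{γ_E(·|η)}(F) = N` over the
`2N²` entry observables of an interior link `e₀` (`N ≥ 2`). [cite: Elitzur1975, (local gauge invariance)] -/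
theorem rayleigh_linkEntries_kernel_sun (hN : 2 ≤ N) (β' : ℝ) (E : Finset (Literature.MathematicalPhysics.QuantumLattice.ZdEdge d))
    (η : LGConfig d (SUN N)) (e₀ : ↥E)
    (hx : ∀ e : Literature.MathematicalPhysics.QuantumLattice.ZdEdge d, (e.1 = e₀.1.1 ∨ e.1 + Pi.single e.2 1 = e₀.1.1) → e ∈ E) :
    (∑ a : Fin N, ∑ b : Fin N, ∑ c ∈ ({(1 : ℂ), -Complex.I} : Finset ℂ), ∑ e : ↥E,
        ∫ U, linkGradSq E (fun m : (↥E → Matrix (Fin N) (Fin N) ℂ) => (m e₀ * Matrix.single b a c).trace.re) e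
          (fun e' => ((U e'.1 : SUN N) : Matrix (Fin N) (Fin N) ℂ)) ∂(ymSpecification (fundamentalRep (Fin N)) β' E η) = ((N : ℝ) - 1 / N) * N) ∧
    (∑ a : Fin N, ∑ b : Fin N, ∑ c ∈ ({(1 : ℂ), -Complex.I} : Finset ℂ),
        Var[fun U : LGConfig d (SUN N) => (((U e₀.1 : SUN N) : Matrix (Fin N) (Fin N) ℂ) * Matrix.single b a c).trace.re;
          ymSpecification (fundamentalRep (Fin N)) β' E η] = N) := by
  classical
  have hN0 : N ≠ 0 := by omega
  set γ := ymSpecification (fundamentalRep (Fin N)) β' E η with hγ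
  haveI : IsProbabilityMeasure γ := isProbabilityMeasure_ymSpecification (fundamentalRep (Fin N)) (continuous_fundamentalRep (n := Fin N)) β' E η
  haveI : SecondCountableTopology (Matrix (Fin N) (Fin N) ℂ) := inferInstanceAs (SecondCountableTopology (Fin N → Fin N → ℂ))
  haveI : SecondCountableTopology (SUN N) := Topology.IsEmbedding.subtypeVal.secondCountableTopology
  have hne : (1 : ℂ) ∉ ({-Complex.I} : Finset ℂ) := by
    rw [Finset.mem_singleton]; intro h; have := congrArg Complex.re h; simp at this
  have key : ∀ M : Matrix (Fin N) (Fin N) ℂ,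
      (∑ e : ↥E, ∫ U, linkGradSq E (fun m : (↥E → Matrix (Fin N) (Fin N) ℂ) => (m e₀ * M).trace.re) e
          (fun e' => ((U e'.1 : SUN N) : Matrix (Fin N) (Fin N) ℂ)) ∂γ =
          ((N : ℝ) - 1 / N) * ∫ g : SUN N, ((g : Matrix (Fin N) (Fin N) ℂ) * M).trace.re ^ 2 ∂(haarSU N)) ∧
      Var[fun U : LGConfig d (SUN N) => (((U e₀.1 : SUN N) : Matrix (Fin N) (Fin N) ℂ) * M).trace.re; γ] =
          ∫ g : SUN N, ((g : Matrix (Fin N) (Fin N) ℂ) * M).trace.re ^ 2 ∂(haarSU N) := by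
    intro M
    set fM : Matrix (Fin N) (Fin N) ℂ → ℝ := fun Q => (Q * M).trace.re with hfM
    have hfc : ContDiff ℝ ∞ fM := contDiff_reTrMul M
    have hgc : Continuous fun g : SUN N => fM g := hfc.continuous.comp continuous_subtype_val
    have hGc : Continuous fun g : SUN N => SUNBakryEmery.Gam fM fM g := (SUNBakryEmery.contDiff_Gam hfc hfc).continuous.comp continuous_subtype_val
    obtain ⟨B, hB⟩ : ∃ B, ∀ g : SUN N, |fM g| ≤ B := by
      obtain ⟨B, hB⟩ := (isCompact_univ (X := SUN N)).exists_bound_of_continuousOn hgc.continuousOn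
      exact ⟨B, fun g => by simpa [Real.norm_eq_abs] using hB g (Set.mem_univ _)⟩
    refine ⟨?_, ?_⟩
    · rw [Finset.sum_eq_single e₀ (fun e _ he => by
        rw [integral_congr_ae (ae_of_all _ fun U => linkGradSq_linkEntry_region_eq hN0 E e₀ M e U)]; simp [he])
        (fun h => absurd (Finset.mem_univ e₀) h)]
      calc _ = ∫ U, SUNBakryEmery.Gam fM fM ((U e₀.1 : SUN N) : Matrix (Fin N) (Fin N) ℂ) ∂γ :=
            integral_congr_ae (ae_of_all _ fun U => by rw [linkGradSq_linkEntry_region_eq hN0 E e₀ M e₀ U, if_pos rfl])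
        _ = ∫ g : SUN N, SUNBakryEmery.Gam fM fM g ∂(haarProbability (SUN N)) :=
            integral_link_eq_haar_kernel_sun β' E η e₀.1 hx (g := fun g : SUN N => SUNBakryEmery.Gam fM fM g) hGc
        _ = ((N : ℝ) - 1 / N) * ∫ g : SUN N, ((g : Matrix (Fin N) (Fin N) ℂ) * M).trace.re ^ 2 ∂(haarSU N) := integral_Gam_reTrMul_sun hN0 M
    · have hmem : MemLp (fun U : LGConfig d (SUN N) => fM ((U e₀.1 : SUN N) : Matrix (Fin N) (Fin N) ℂ)) 2 γ :=
        MemLp.of_bound ((hgc.comp (continuous_apply e₀.1)).aestronglyMeasurable) B (ae_of_all _ fun U => by rw [Real.norm_eq_abs]; exact hB _)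
      have h1 := integral_link_eq_haar_kernel_sun β' E η e₀.1 hx (g := fun g : SUN N => fM g) hgc
      have h2 := integral_link_eq_haar_kernel_sun β' E η e₀.1 hx (g := fun g : SUN N => fM g ^ 2) (hgc.pow 2)
      rw [integral_reTrMul_eq_zero_sun hN M] at h1
      rw [variance_eq_sub hmem]
      show (∫ U, fM ((U e₀.1 : SUN N) : Matrix (Fin N) (Fin N) ℂ) ^ 2 ∂γ) - (∫ U, fM ((U e₀.1 : SUN N) : Matrix (Fin N) (Fin N) ℂ) ∂γ) ^ 2 = _
      rw [h2, h1, zero_pow two_ne_zero, sub_zero]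
  have k1 := fun M : Matrix (Fin N) (Fin N) ℂ => (key M).1
  have k2 := fun M : Matrix (Fin N) (Fin N) ℂ => (key M).2
  refine ⟨?_, ?_⟩
  · rw [Finset.sum_congr rfl fun a _ => Finset.sum_congr rfl fun b _ => Finset.sum_congr rfl fun c _ => k1 (Matrix.single b a c)]
    simp_rw [Finset.sum_insert hne, Finset.sum_singleton, ← mul_add, ← Finset.mul_sum]
    rw [sum_integral_sq_entries_sun hN0]
  · rw [Finset.sum_congr rfl fun a _ => Finset.sum_congr rfl fun b _ => Finset.sum_congr rfl fun c _ => k2 (Matrix.single b a c)]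
    simp_rw [Finset.sum_insert hne, Finset.sum_singleton]
    exact sum_integral_sq_entries_sun hN0

/-! ## §3. The ceiling for the uniform kernel Poincaré constant -/

/-- ★★★ **THE HAAR CEILING FOR THE DLR KERNELS**: for every region `E` containing the whole star of some site (`e₀ = (x,i) ∈ E` and every link touching
`x` in `E`), every boundary condition `η`, every coupling `β'`, `N ≥ 2`: if `K·Var_{γ_E(·|η)}(F) ≤ Σ_{e∈E} ∫ linkGradSq E f e dγ_E(·|η)` for every smooth
`f` of the link matrices over `E`, then `K ≤ N − 1/N` — so the UNIFORM kernel Poincaré constant of G32 (`N/2 − 4dN|β|`) is within a factor `< 2` of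
optimal and no uniform constant can beat `(N² − 1)/N`, whatever the coupling.  The Yang–Mills mass gap is NOT proved. [cite: Elitzur1975, (local gauge invariance)] -/
theorem kernelPoincareConst_le_haarCeiling_sun (hN : 2 ≤ N) (β' : ℝ) (E : Finset (Literature.MathematicalPhysics.QuantumLattice.ZdEdge d))
    (η : LGConfig d (SUN N)) (e₀ : ↥E)
    (hx : ∀ e : Literature.MathematicalPhysics.QuantumLattice.ZdEdge d, (e.1 = e₀.1.1 ∨ e.1 + Pi.single e.2 1 = e₀.1.1) → e ∈ E) {K : ℝ}
    (hK : ∀ f : (↥E → Matrix (Fin N) (Fin N) ℂ) → ℝ, ContDiff ℝ ∞ f →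
      K * Var[matrixCylinder E f; ymSpecification (fundamentalRep (Fin N)) β' E η] ≤
        ∑ e : ↥E, ∫ U, linkGradSq E f e (fun e' : ↥E => ((U e'.1 : SUN N) : Matrix (Fin N) (Fin N) ℂ)) ∂(ymSpecification (fundamentalRep (Fin N)) β' E η)) :
    K ≤ (N : ℝ) - 1 / N := by
  classical
  obtain ⟨hG, hV⟩ := rayleigh_linkEntries_kernel_sun hN β' E η e₀ hx
  have hNpos : (0 : ℝ) < N := by exact_mod_cast (show 0 < N by omega)
  have hone : ∀ M : Matrix (Fin N) (Fin N) ℂ,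
      K * Var[fun U : LGConfig d (SUN N) => (((U e₀.1 : SUN N) : Matrix (Fin N) (Fin N) ℂ) * M).trace.re; ymSpecification (fundamentalRep (Fin N)) β' E η] ≤
        ∑ e : ↥E, ∫ U, linkGradSq E (fun m : (↥E → Matrix (Fin N) (Fin N) ℂ) => (m e₀ * M).trace.re) e
          (fun e' => ((U e'.1 : SUN N) : Matrix (Fin N) (Fin N) ℂ)) ∂(ymSpecification (fundamentalRep (Fin N)) β' E η) := by
    intro M
    have hf : ContDiff ℝ ∞ (fun m : (↥E → Matrix (Fin N) (Fin N) ℂ) => (m e₀ * M).trace.re) :=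
      (contDiff_reTrMul M).comp (contDiff_apply ℝ (Matrix (Fin N) (Fin N) ℂ) e₀)
    have h := hK _ hf
    have hcyl : (matrixCylinder E (fun m : (↥E → Matrix (Fin N) (Fin N) ℂ) => (m e₀ * M).trace.re) : LGConfig d (SUN N) → ℝ) =
        fun U => (((U e₀.1 : SUN N) : Matrix (Fin N) (Fin N) ℂ) * M).trace.re := by
      funext U; rfl
    rw [hcyl] at h
    exact h
  have hsum := Finset.sum_le_sum fun a (_ : a ∈ (Finset.univ : Finset (Fin N))) =>
    Finset.sum_le_sum fun b (_ : b ∈ (Finset.univ : Finset (Fin N))) =>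
      Finset.sum_le_sum fun c (_ : c ∈ ({(1 : ℂ), -Complex.I} : Finset ℂ)) => hone (Matrix.single b a c)
  simp only [← Finset.mul_sum] at hsum
  rw [hV, hG] at hsum
  exact le_of_mul_le_mul_right hsum hNpos

/-- ★★ **The window for the optimal UNIFORM kernel Poincaré constant at strong coupling**: for `|β| < 1/(8d)` the constant `K = N/2 − 4dN|β|` is
admissible for EVERY region and boundary condition (G32), and for every region containing a full star no admissible constant exceeds `N − 1/N` (§3).
The Yang–Mills mass gap is NOT proved. [cite: ShenZhuZhu2022, Remark 1.3] -/
theorem kernelPoincareConst_window_sun (hN : 2 ≤ N) {β : ℝ} (hKpos : 0 < (N : ℝ) / 2 - N * |β| * (4 * d))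
    (E : Finset (Literature.MathematicalPhysics.QuantumLattice.ZdEdge d)) (η : LGConfig d (SUN N)) (e₀ : ↥E)
    (hx : ∀ e : Literature.MathematicalPhysics.QuantumLattice.ZdEdge d, (e.1 = e₀.1.1 ∨ e.1 + Pi.single e.2 1 = e₀.1.1) → e ∈ E) :
    (∀ f : (↥E → Matrix (Fin N) (Fin N) ℂ) → ℝ, ContDiff ℝ ∞ f →
      ((N : ℝ) / 2 - N * |β| * (4 * d)) * Var[matrixCylinder E f; ymSpecification (fundamentalRep (Fin N)) ((N : ℝ) * β) E η] ≤
        ∑ e : ↥E, ∫ U, linkGradSq E f e (fun e' : ↥E => ((U e'.1 : SUN N) : Matrix (Fin N) (Fin N) ℂ)) ∂(ymSpecification (fundamentalRep (Fin N)) ((N : ℝ) * β) E η)) ∧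
    (∀ K' : ℝ, (∀ f : (↥E → Matrix (Fin N) (Fin N) ℂ) → ℝ, ContDiff ℝ ∞ f →
      K' * Var[matrixCylinder E f; ymSpecification (fundamentalRep (Fin N)) ((N : ℝ) * β) E η] ≤
        ∑ e : ↥E, ∫ U, linkGradSq E f e (fun e' : ↥E => ((U e'.1 : SUN N) : Matrix (Fin N) (Fin N) ℂ)) ∂(ymSpecification (fundamentalRep (Fin N)) ((N : ℝ) * β) E η)) →
      K' ≤ (N : ℝ) - 1 / N) := by
  have hN0 : N ≠ 0 := by omega
  refine ⟨fun f hf => ?_, fun K' hK' => kernelPoincareConst_le_haarCeiling_sun hN _ E η e₀ hx hK'⟩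
  have h := kernel_variance_le_linkGradSq_sun E η (regionWilsonHessianBound_four_d_sun d N) hN0 β hKpos hf
  rwa [le_div_iff₀ hKpos, mul_comm] at h

end Summit.QuantumFields.YangMills.Theorems.ColdStartUniversality

end
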